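import Literature.MathematicalPhysics.StatisticalMechanics.ComplexSpinChiralLROMonotone
import HarnessLib

/-!
# The fluctuation constant bounded through the antipodal symmetry: `S(ν) ≤ νR(ν) - 1 + 1/(2√(2ν))`
# (Salmhofer–Seiler, CMP 139 (1991), Remark A.1/A.5, Prop. 4.2 (2), Cor. 4.9 and (A.60))

Sixteenth file of the Salmhofer–Seiler series; theorems only (no definition, no named fact).
`ComplexSpinFluctuationBound` proves Remark A.5 (A.28), `S(ν) ≤ νR(ν) - 3/4` (`fluctS_le`), by the
printed Remark A.1: mode by mode `h_ν(ν - C) + h_ν(ν + C) ≥ 3/2` and the fold `k ↦ k + π̂`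
(`C ↦ -C`); `ComplexSpinFluctuationVanishing` proves `1 - (2π)^{-ν}∫h_ν(D) ≤ 1/√(2ν)` by AM–GM and
the second moment `(2π)^{-ν}∫C² = ν/2`, ignoring the fold.  COMBINING the two printed devices gives,
at no extra cost, the sharper

* `one_sub_avgCompTerm_le_half` — **`1 - (2π)^{-ν}∫_{[-π,π]^ν} h_ν(D) ≤ 1/(2√(2ν))`**: under the
  fold, `(1 - h_ν(ν - C)) + (1 - h_ν(ν + C)) = |C|/(ν + |C|) ≤ |C|/ν ≤ ε + C²/(4εν²)` mode by
  mode (the AM–GM majorant is needed on ONE half of the zone only), so that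
  `1 - (2π)^{-ν}∫h_ν ≤ ε/2 + (ν/2)/(8εν²)`, `= 1/(2√(2ν))` at `ε = 1/(2√(2ν))` (lattice sums on even
  tori `(ℤ/Lℤ)^ν`, then `L → ∞` by the tree's uniform Riemann sums);
* `fluctS_le_antipodal` — **Prop. 4.2 (2) sharpened: `S(ν) ≤ νR(ν) - 1 + 1/(2√(2ν))`** (`ν ≥ 3`;
  at `ν = 4`: `4R(4) - 0.823` against the printed `4R(4) - 3/4`), and `fluctS_le_antipodal_dim`:
  `S(ν) ≤ 2/(ν-2) + 1/(2√(2ν))` (against `2/(ν-2) + 1/4` printed and `2/(ν-2) + 1/√(2ν)` in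
  `ComplexSpinFluctuationVanishing`);
* `fluctS_le_antipodal_of_le`, `chiralLRO_of_latticeGreen_lt_antipodal` — the bound is decreasing in
  `ν` (Proposition A.6), hence Thm. 4.8 / Cor. 4.9 in all `ν ≥ ν₀` from ONE inequality
  `2(ν₀R(ν₀) - 1 + 1/(2√(2ν₀)))K(N)/N < 1`;
* the (A.60)-type corollaries with the printed computer-assisted values of `R(ν₀)` as HYPOTHESES,
  now reaching the printed scope of Cor. 4.9 for `N = 3` and improving the tree's table
  (`ComplexSpinChiralLROMonotone`: `U(3)` for `ν ≥ 5` from `R(5)`, `U(4)` for `ν ≥ 7` from `R(7)`):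
  `u3_chiralLRO_of_latticeGreen_four_lt'` — **`R(4) < 5/16` ⇒ `U(3)` for all `ν ≥ 4`** (the printed
  claim "`N = 1,…,4`, `ν ≥ 4`" for `N = 3`, which the print obtains from the numerics `S(4) < 0.35`);
  `u4_chiralLRO_of_latticeGreen_five_lt'` — `R(5) < 6/25` ⇒ `U(4)` for all `ν ≥ 5`;
  `u5_chiralLRO_of_latticeGreen_seven_lt` — `R(7) < 369/2324` ⇒ `U(5)` (corrected `K(5) = 12227/1330`)
  for all `ν ≥ 7`.

The hypothesis `R(4) < 5/16` is discharged by the kernel in `LatticeGreenFourCertificate.lean`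
(`latticeGreen_four_zero_lt`); `ComplexSpinChiralLROCertified.lean` assembles the unconditional
statements.  What is NOT reached: `U(4)` at `ν = 4` (needs `S(4) < 0.3614`; `S(4) ≈ 0.333`, printed
`< 0.35`, Prop. 4.2 (4)) and `U(5)` at `ν = 5, 6`.  Honest framing: `β = 0` complex spin systems on
even tori, `m = 0`; nothing about `β > 0`, the continuum, `SU(N)` or the summit's `QCD` conjunct.

## References

* M. Salmhofer, E. Seiler, Commun. Math. Phys. 139 (1991) 395–432: (4.1)–(4.5), Prop. 4.2,
  Thm. 4.8, Cor. 4.9, Appendix (A.2)–(A.6) (Remark A.1), (A.28) (Remark A.5), Proposition A.6,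
  (A.59)–(A.61) and p. 430 (`R(4) ≤ 0.3100`, `R(5) ≤ 0.2313`, `R(7) ≤ 0.1564`). [SalmhoferSeiler1991]

## Mathlib

`MeasureTheory.integral_fintype_prod_eq_prod` (Fubini over `[-π,π]^ν`), `integral_cos`,
`integral_cos_sq`, `Equiv.sum_comp`, `Real.le_sqrt`.
-/

noncomputable section

open MeasureTheory Set Filter Finset Real
open Literature.Probability.LatticeModels

namespace Literature.MathematicalPhysics.StatisticalMechanics

namespace ComplexSpin

variable {ν : ℕ}

/-! ### Second moment of `C(k) = ∑_μ cos k_μ` over the Brillouin zone: `(2π)^{-ν}∫ C² = ν/2` -/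

/-- Fubini for product integrands over `[-π,π]^ν`. [folklore] -/
private theorem integral_brillouin_prod (f : Fin ν → ℝ → ℝ) :
    ∫ p in brillouin ν, ∏ i, f i (p i) = ∏ i, ∫ t in Icc (-π) π, f i t := by
  rw [volume_restrict_brillouin, integral_fintype_prod_eq_prod]

/-- `∫_{-π}^{π} 1 = 2π`. [folklore] -/
private theorem integral_Icc_one : ∫ _t in Icc (-π) π, (1 : ℝ) = 2 * π := by
  rw [setIntegral_const, Real.volume_real_Icc_of_le (by linarith [Real.pi_pos]), smul_eq_mul,
    mul_one]
  ring

/-- `∫_{-π}^{π} cos = 0`. [folklore] -/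
private theorem integral_Icc_cos : ∫ t in Icc (-π) π, Real.cos t = 0 := by
  rw [integral_Icc_eq_integral_Ioc, ← intervalIntegral.integral_of_le (by linarith [Real.pi_pos]),
    integral_cos]
  simp

/-- `∫_{-π}^{π} cos² = π`. [folklore] -/
private theorem integral_Icc_cos_sq : ∫ t in Icc (-π) π, Real.cos t ^ 2 = π := by
  rw [integral_Icc_eq_integral_Ioc, ← intervalIntegral.integral_of_le (by linarith [Real.pi_pos]),
    integral_cos_sq]
  simp [Real.sin_pi, Real.cos_pi]

/-- Cross terms vanish: `∫ cos k_μ cos k_{μ'} = 0` for `μ ≠ μ'`. [folklore] -/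
private theorem integral_brillouin_cos_mul_cos_of_ne {μ μ' : Fin ν} (h : μ ≠ μ') :
    ∫ p in brillouin ν, Real.cos (p μ) * Real.cos (p μ') = 0 := by
  classical
  have hf : (fun p : Fin ν → ℝ => Real.cos (p μ) * Real.cos (p μ')) =
      fun p => ∏ i, ((if i = μ then Real.cos (p i) else 1) * (if i = μ' then Real.cos (p i) else 1)) := by
    funext p
    rw [Finset.prod_mul_distrib, Fintype.prod_ite_eq', Fintype.prod_ite_eq']
  rw [hf, integral_brillouin_prod
    (fun i t => (if i = μ then Real.cos t else 1) * (if i = μ' then Real.cos t else 1))]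
  refine Finset.prod_eq_zero (Finset.mem_univ μ) ?_
  simp only [if_neg h, mul_one]
  exact integral_Icc_cos

/-- Diagonal terms: `∫ cos² k_μ = π (2π)^{ν-1}`. [folklore] -/
private theorem integral_brillouin_cos_sq (μ : Fin ν) :
    ∫ p in brillouin ν, Real.cos (p μ) * Real.cos (p μ) = π * (2 * π) ^ (ν - 1) := by
  classical
  have hf : (fun p : Fin ν → ℝ => Real.cos (p μ) * Real.cos (p μ)) =
      fun p => ∏ i, (if i = μ then Real.cos (p i) ^ 2 else 1) := by
    funext p
    rw [Fintype.prod_ite_eq', sq]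
  rw [hf, integral_brillouin_prod (fun i t => if i = μ then Real.cos t ^ 2 else 1)]
  have hi : ∀ i : Fin ν, (∫ t in Icc (-π) π, (fun i t => if i = μ then Real.cos t ^ 2 else (1 : ℝ)) i t) =
      if i = μ then π else 2 * π := by
    intro i
    split_ifs with hiμ
    · simp only [hiμ, if_true]; exact integral_Icc_cos_sq
    · simp only [hiμ, if_false]; exact integral_Icc_one
  simp_rw [hi]
  rw [← Finset.mul_prod_erase Finset.univ _ (Finset.mem_univ μ), if_pos rfl]
  congr 1
  rw [Finset.prod_congr rfl fun i hi => by rw [if_neg (Finset.ne_of_mem_erase hi)],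
    Finset.prod_const, Finset.card_erase_of_mem (Finset.mem_univ μ), Finset.card_univ,
    Fintype.card_fin]

/-- `(2π)^{-ν}∫_{[-π,π]^ν} C(k)² d^νk = ν/2`, `C(k) = ∑_μ cos k_μ`. [folklore] -/
private theorem integral_brillouin_cosSum_sq :
    ∫ p in brillouin ν, (∑ μ, Real.cos (p μ)) ^ 2 = (ν : ℝ) / 2 * (2 * π) ^ ν := by
  classical
  have hexp : (fun p : Fin ν → ℝ => (∑ μ, Real.cos (p μ)) ^ 2) =
      fun p => ∑ μ, ∑ μ', Real.cos (p μ) * Real.cos (p μ') := by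
    funext p
    rw [sq, Finset.sum_mul_sum]
  have hint : ∀ μ μ' : Fin ν, Integrable (fun p : Fin ν → ℝ => Real.cos (p μ) * Real.cos (p μ'))
      (volume.restrict (brillouin ν)) := fun μ μ' =>
    (by fun_prop : Continuous fun p : Fin ν → ℝ =>
      Real.cos (p μ) * Real.cos (p μ')).continuousOn.integrableOn_compact (isCompact_brillouin ν)
  rw [hexp, integral_finsetSum _ (fun μ _ => integrable_finsetSum _ fun μ' _ => hint μ μ')]
  simp_rw [integral_finsetSum _ (fun μ' _ => hint _ μ')]
  have hinner : ∀ μ : Fin ν, ∑ μ', ∫ p in brillouin ν, Real.cos (p μ) * Real.cos (p μ') =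
      π * (2 * π) ^ (ν - 1) := by
    intro μ
    rw [Finset.sum_eq_single μ]
    · exact integral_brillouin_cos_sq μ
    · intro μ' _ hne
      exact integral_brillouin_cos_mul_cos_of_ne (Ne.symm hne)
    · intro h; exact absurd (Finset.mem_univ μ) h
  simp_rw [hinner]
  rw [Finset.sum_const, Finset.card_univ, Fintype.card_fin, nsmul_eq_mul]
  rcases Nat.eq_zero_or_pos ν with rfl | hν
  · simp
  · obtain ⟨n, rfl⟩ : ∃ n, ν = n + 1 := ⟨ν - 1, by omega⟩
    rw [Nat.add_sub_cancel, pow_succ]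
    push_cast
    ring

/-- `ν - D(k) = C(k)` with `D = ∑_μ(1 - cos k_μ)`. [cite: SalmhoferSeiler1991, (4.1)] -/
private theorem sub_dispersion_eq (p : Fin ν → ℝ) :
    (ν : ℝ) - dispersion p = ∑ μ, Real.cos (p μ) := by
  unfold dispersion
  rw [Finset.sum_sub_distrib, Finset.sum_const, Finset.card_univ, Fintype.card_fin, nsmul_eq_mul,
    mul_one]
  ring

/-- `(2π)^{-ν}∫ (ν - D)² = ν/2`. [folklore] -/
private theorem integral_brillouin_sub_dispersion_sq :
    (∫ p in brillouin ν, ((ν : ℝ) - dispersion p) ^ 2) / (2 * π) ^ ν = (ν : ℝ) / 2 := by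
  simp_rw [sub_dispersion_eq]
  rw [integral_brillouin_cosSum_sq]
  have h : (0 : ℝ) < (2 * π) ^ ν := by positivity
  field_simp

/-! ### Remark A.1 and AM–GM under the fold `C ↦ -C`, mode by mode -/

/-- **The folded AM–GM majorant**: for real `c` and `ε > 0`,
`(1 - h_ν(ν - c)) + (1 - h_ν(ν + c)) ≤ ε + c²/(4εν²)` (`h_ν(D) = ν/max(ν, D)`; one of the two terms
vanishes, the other is `|c|/(ν + |c|) ≤ |c|/ν`). [cite: SalmhoferSeiler1991, Remark A.1 (A.6) with Lemma A.7] -/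
private theorem one_sub_compTerm_pair_le (hν : 1 ≤ ν) {ε : ℝ} (hε : 0 < ε) (c : ℝ) :
    (1 - compTerm ν ((ν : ℝ) - c)) + (1 - compTerm ν ((ν : ℝ) + c)) ≤
      ε + c ^ 2 / (4 * ε * (ν : ℝ) ^ 2) := by
  have hν' : (0 : ℝ) < ν := by exact_mod_cast hν
  have hamgm : |c| / ν ≤ ε + c ^ 2 / (4 * ε * (ν : ℝ) ^ 2) := by
    have hkey : ε + c ^ 2 / (4 * ε * (ν : ℝ) ^ 2) - |c| / ν = (|c| / ν - 2 * ε) ^ 2 / (4 * ε) := by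
      have : c ^ 2 = |c| ^ 2 := (sq_abs c).symm
      rw [this]
      field_simp
      ring
    have : 0 ≤ (|c| / ν - 2 * ε) ^ 2 / (4 * ε) := by positivity
    linarith
  unfold compTerm
  rcases le_or_gt 0 c with hc | hc
  · rw [max_eq_left (by linarith), div_self hν'.ne', max_eq_right (by linarith)]
    have hD : (ν : ℝ) + c ≠ 0 := by linarith
    have h1 : 1 - (ν : ℝ) / (ν + c) = c / (ν + c) := by
      field_simp
      ring
    have h2 : c / (ν + c) ≤ c / ν := div_le_div_of_nonneg_left hc hν' (by linarith)
    rw [abs_of_nonneg hc] at hamgm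
    linarith
  · rw [max_eq_right (by linarith), max_eq_left (by linarith), div_self hν'.ne']
    have hD : (ν : ℝ) - c ≠ 0 := by linarith
    have h1 : 1 - (ν : ℝ) / (ν - c) = -c / (ν - c) := by
      field_simp
      ring
    have h2 : -c / (ν - c) ≤ -c / ν := div_le_div_of_nonneg_left (by linarith) hν' (by linarith)
    rw [abs_of_neg hc] at hamgm
    linarith

section Lattice

variable {L : ℕ} [NeZero L]

/-- **The folded AM–GM bound summed over the dual torus** (even `L`, `ε > 0`):
`∑_χ (1 - h_ν(D(χ))) ≤ (ε/2)|Λ̂| + (8εν²)⁻¹ ∑_χ C(χ)²` — the bijection `χ ↦ ε̂ + χ` (`C ↦ -C`, the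
fold `k ↦ k + π̂` of (A.5)) pairs the modes. [cite: SalmhoferSeiler1991, Remark A.1 (A.5)–(A.6)] -/
theorem sum_one_sub_compTerm_le (hν : 1 ≤ ν) (hL : 2 ∣ L) {ε : ℝ} (hε : 0 < ε) :
    ∑ χ : AddChar (TorusSite ν L) ℂ, (1 - compTerm ν (ν - cosSum χ)) ≤
      ε / 2 * (Fintype.card (AddChar (TorusSite ν L) ℂ) : ℝ) +
        (8 * ε * (ν : ℝ) ^ 2)⁻¹ * ∑ χ : AddChar (TorusSite ν L) ℂ, cosSum χ ^ 2 := by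
  set e := stagChar (ν := ν) hL with he
  have hshift : ∑ χ : AddChar (TorusSite ν L) ℂ, (1 - compTerm ν (ν - cosSum χ)) =
      ∑ χ : AddChar (TorusSite ν L) ℂ, (1 - compTerm ν (ν + cosSum χ)) := by
    rw [← Equiv.sum_comp (Equiv.addLeft e) (fun χ => 1 - compTerm ν (ν - cosSum χ))]
    refine Finset.sum_congr rfl fun χ _ => ?_
    simp only [Equiv.coe_addLeft, he, cosSum_stagChar_add hL χ, sub_neg_eq_add]
  have hsum : 2 * ∑ χ : AddChar (TorusSite ν L) ℂ, (1 - compTerm ν (ν - cosSum χ)) =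
      ∑ χ : AddChar (TorusSite ν L) ℂ,
        ((1 - compTerm ν (ν - cosSum χ)) + (1 - compTerm ν (ν + cosSum χ))) := by
    rw [two_mul, Finset.sum_add_distrib, ← hshift]
  have hbound : ∑ χ : AddChar (TorusSite ν L) ℂ,
      ((1 - compTerm ν (ν - cosSum χ)) + (1 - compTerm ν (ν + cosSum χ))) ≤
        ∑ χ : AddChar (TorusSite ν L) ℂ, (ε + cosSum χ ^ 2 / (4 * ε * (ν : ℝ) ^ 2)) :=
    Finset.sum_le_sum fun χ _ => one_sub_compTerm_pair_le hν hε (cosSum χ)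
  have hR : ∑ χ : AddChar (TorusSite ν L) ℂ, (ε + cosSum χ ^ 2 / (4 * ε * (ν : ℝ) ^ 2)) =
      ε * (Fintype.card (AddChar (TorusSite ν L) ℂ) : ℝ) +
        (∑ χ : AddChar (TorusSite ν L) ℂ, cosSum χ ^ 2) / (4 * ε * (ν : ℝ) ^ 2) := by
    rw [Finset.sum_add_distrib, Finset.sum_const, nsmul_eq_mul, Finset.card_univ, Finset.sum_div]
    ring
  have h2 : 2 * ∑ χ : AddChar (TorusSite ν L) ℂ, (1 - compTerm ν (ν - cosSum χ)) ≤
      ε * (Fintype.card (AddChar (TorusSite ν L) ℂ) : ℝ) +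
        (∑ χ : AddChar (TorusSite ν L) ℂ, cosSum χ ^ 2) / (4 * ε * (ν : ℝ) ^ 2) := by
    rw [hsum, ← hR]
    exact hbound
  have hν' : (0 : ℝ) < ν := by exact_mod_cast hν
  have hrw : (8 * ε * (ν : ℝ) ^ 2)⁻¹ * ∑ χ : AddChar (TorusSite ν L) ℂ, cosSum χ ^ 2 =
      (∑ χ : AddChar (TorusSite ν L) ℂ, cosSum χ ^ 2) / (4 * ε * (ν : ℝ) ^ 2) / 2 := by
    field_simp
    ring
  rw [hrw]
  linarith

/-- Momentum form: `L^{-ν}∑_k (1 - h_ν(D(p_k))) ≤ ε/2 + (8εν²)⁻¹ L^{-ν}∑_k (ν - D(p_k))²` (even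
`L ≥ 2`). [cite: SalmhoferSeiler1991, Remark A.1 (A.5)–(A.6)] -/
theorem momentumAverage_one_sub_compTerm_le (hν : 1 ≤ ν) (hL : Even L) (hL2 : 2 ≤ L) {ε : ℝ}
    (hε : 0 < ε) :
    ((L : ℝ) ^ ν)⁻¹ * ∑ k : TorusSite ν L, (1 - compTerm ν (dispersion (latticeMomentum L k))) ≤
      ε / 2 + (8 * ε * (ν : ℝ) ^ 2)⁻¹ *
        (((L : ℝ) ^ ν)⁻¹ * ∑ k : TorusSite ν L, ((ν : ℝ) - dispersion (latticeMomentum L k)) ^ 2) := by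
  have h := sum_one_sub_compTerm_le (ν := ν) (L := L) hν hL.two_dvd hε
  rw [← momentumChar_bijective.sum_comp (fun χ : AddChar (TorusSite ν L) ℂ =>
      1 - compTerm ν (ν - cosSum χ)),
    ← momentumChar_bijective.sum_comp (fun χ : AddChar (TorusSite ν L) ℂ => cosSum χ ^ 2),
    AddChar.card_eq, card_torusSite] at h
  simp only [cosSum_momentumChar hL2, sub_sub_cancel] at h
  push_cast at h
  have hL0 : (0 : ℝ) < (L : ℝ) ^ ν := pow_pos (by exact_mod_cast Nat.pos_of_ne_zero (NeZero.ne L)) ν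
  rw [← sub_nonneg] at h ⊢
  have : ε / 2 + (8 * ε * (ν : ℝ) ^ 2)⁻¹ *
      (((L : ℝ) ^ ν)⁻¹ * ∑ k : TorusSite ν L, ((ν : ℝ) - dispersion (latticeMomentum L k)) ^ 2) -
      ((L : ℝ) ^ ν)⁻¹ * ∑ k : TorusSite ν L, (1 - compTerm ν (dispersion (latticeMomentum L k))) =
      ((L : ℝ) ^ ν)⁻¹ * (ε / 2 * (L : ℝ) ^ ν + (8 * ε * (ν : ℝ) ^ 2)⁻¹ *
        ∑ k : TorusSite ν L, ((ν : ℝ) - dispersion (latticeMomentum L k)) ^ 2 -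
        ∑ k : TorusSite ν L, (1 - compTerm ν (dispersion (latticeMomentum L k)))) := by
    field_simp
  rw [this]
  exact mul_nonneg (inv_nonneg.2 hL0.le) h

/-- `D` is `2π`-periodic in each coordinate. [folklore] -/
private theorem dispersion_periodic (p : Fin ν → ℝ) (n : Fin ν → ℤ) :
    dispersion (fun i => p i + 2 * π * (n i : ℝ)) = dispersion p := by
  unfold dispersion
  refine Finset.sum_congr rfl fun i _ => ?_
  show 1 - Real.cos (p i + 2 * π * (n i : ℝ)) = 1 - Real.cos (p i)
  rw [show p i + 2 * π * (n i : ℝ) = p i + (n i : ℤ) * (2 * π) by ring,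
    Real.cos_add_int_mul_two_pi]

/-- Riemann sums of the second moment: for `δ > 0` and all large even `L`,
`|L^{-ν}∑_k (ν - D(p_k))² - (2π)^{-ν}∫ (ν - D)²| ≤ δ`. [cite: FriedliVelenik2017, §10.5.2 (10.41)] -/
private theorem momentumAverage_sub_dispersion_sq_approx {δ : ℝ} (hδ : 0 < δ) :
    ∃ L₀ : ℕ, ∀ (L : ℕ) [NeZero L], Even L → L₀ ≤ L →
      |((L : ℝ) ^ ν)⁻¹ * ∑ k : TorusSite ν L, ((ν : ℝ) - dispersion (latticeMomentum L k)) ^ 2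
        - (∫ p in brillouin ν, ((ν : ℝ) - dispersion p) ^ 2) / ((2 * Real.pi) ^ ν)| ≤ δ := by
  have hcont : Continuous fun p : Fin ν → ℝ => ((ν : ℝ) - dispersion p) ^ 2 :=
    (continuous_const.sub (continuous_dispersion ν)).pow 2
  obtain ⟨L₀, hL₀⟩ := momentumAverage_uniform_approx (d := ν) (Y := Unit) (E := ℝ)
    (C := Set.univ) isCompact_univ (G := fun p _ => ((ν : ℝ) - dispersion p) ^ 2)
    ((hcont.comp continuous_fst).continuousOn)
    (fun p _ n => by simp only [dispersion_periodic p n]) hδ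
  refine ⟨L₀, fun L _ hLe hL => ?_⟩
  have h := hL₀ L hL hLe () (Set.mem_univ _)
  rw [Real.norm_eq_abs] at h
  simp only [smul_eq_mul] at h
  push_cast at h
  rwa [div_eq_inv_mul]

/-- `L^{-ν}∑_k 1 = 1`. [folklore] -/
private theorem momentumAverage_one : ((L : ℝ) ^ ν)⁻¹ * ∑ _k : TorusSite ν L, (1 : ℝ) = 1 := by
  rw [Finset.sum_const, Finset.card_univ, card_torusSite, nsmul_eq_mul, mul_one]
  exact_mod_cast inv_mul_cancel₀ (pow_ne_zero ν (show (L : ℝ) ≠ 0 by exact_mod_cast NeZero.ne L))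

end Lattice

/-! ### The limit `L → ∞`: `1 - (2π)^{-ν}∫h_ν(D) ≤ 1/(2√(2ν))` -/

/-- For every `ε > 0`: `1 - (2π)^{-ν}∫ h_ν(D) ≤ ε/2 + 1/(16εν)` (the folded AM–GM bound in the
thermodynamic limit, with `(2π)^{-ν}∫(ν - D)² = ν/2`). [cite: SalmhoferSeiler1991, Remark A.1 (A.6) and Lemma A.7 (A.36)] -/
theorem one_sub_avgCompTerm_le_eps_half (hν : 1 ≤ ν) {ε : ℝ} (hε : 0 < ε) :
    1 - (∫ p in brillouin ν, compTerm ν (dispersion p)) / ((2 * Real.pi) ^ ν) ≤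
      ε / 2 + 1 / (16 * ε * ν) := by
  have hν' : (0 : ℝ) < ν := by exact_mod_cast hν
  refine le_of_forall_pos_le_add fun δ hδ => ?_
  -- choose the Riemann-sum accuracy
  set δ' : ℝ := δ / (1 + (8 * ε * (ν : ℝ) ^ 2)⁻¹) with hδ'
  have hc : 0 < 1 + (8 * ε * (ν : ℝ) ^ 2)⁻¹ := by positivity
  have hδ'pos : 0 < δ' := div_pos hδ hc
  obtain ⟨L₁, hL₁⟩ := momentumAverage_compTerm_approx (ν := ν) hν hδ'pos
  obtain ⟨L₂, hL₂⟩ := momentumAverage_sub_dispersion_sq_approx (ν := ν) hδ'pos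
  set L : ℕ := 2 * (max (max L₁ L₂) 2) with hLdef
  haveI : NeZero L := ⟨by rw [hLdef]; omega⟩
  have hL1 : L₁ ≤ L := by rw [hLdef]; omega
  have hL2' : L₂ ≤ L := by rw [hLdef]; omega
  have hL2 : 2 ≤ L := by rw [hLdef]; omega
  have hev : Even L := ⟨max (max L₁ L₂) 2, by rw [hLdef]; ring⟩
  have h1 := abs_le.1 (hL₁ L hev hL1)
  have h2 := abs_le.1 (hL₂ L hev hL2')
  have h3 := momentumAverage_one_sub_compTerm_le (ν := ν) (L := L) hν hev hL2 hε
  rw [Finset.sum_sub_distrib, mul_sub, momentumAverage_one] at h3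
  rw [integral_brillouin_sub_dispersion_sq] at h2
  have hcoef : 0 ≤ (8 * ε * (ν : ℝ) ^ 2)⁻¹ := by positivity
  have h4 : (8 * ε * (ν : ℝ) ^ 2)⁻¹ * (((L : ℝ) ^ ν)⁻¹ *
      ∑ k : TorusSite ν L, ((ν : ℝ) - dispersion (latticeMomentum L k)) ^ 2) ≤
      (8 * ε * (ν : ℝ) ^ 2)⁻¹ * ((ν : ℝ) / 2 + δ') :=
    mul_le_mul_of_nonneg_left (by linarith [h2.2]) hcoef
  have h5 : (8 * ε * (ν : ℝ) ^ 2)⁻¹ * ((ν : ℝ) / 2) = 1 / (16 * ε * ν) := by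
    field_simp
    ring
  have h6 : δ' + (8 * ε * (ν : ℝ) ^ 2)⁻¹ * δ' = δ := by
    rw [hδ']
    field_simp [hc.ne']
  nlinarith [h1.1, h1.2, h4, h5, h6]

/-- **`1 - (2π)^{-ν}∫_{[-π,π]^ν} h_ν(D) ≤ 1/(2√(2ν))`** (`ν ≥ 1`): half the bound of
`ComplexSpinFluctuationVanishing.one_sub_avgCompTerm_le`, by the fold `k ↦ k + π̂` of Remark A.1.
[cite: SalmhoferSeiler1991, Remark A.1 (A.5)–(A.6) with Lemma A.7] -/
theorem one_sub_avgCompTerm_le_half (hν : 1 ≤ ν) :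
    1 - (∫ p in brillouin ν, compTerm ν (dispersion p)) / ((2 * Real.pi) ^ ν) ≤
      1 / (2 * Real.sqrt (2 * ν)) := by
  have hν' : (0 : ℝ) < ν := by exact_mod_cast hν
  set s : ℝ := Real.sqrt (2 * ν) with hs
  have hspos : 0 < s := Real.sqrt_pos.2 (by positivity)
  have hs2 : s ^ 2 = 2 * ν := Real.sq_sqrt (by positivity)
  have h := one_sub_avgCompTerm_le_eps_half (ν := ν) hν (ε := 1 / (2 * s)) (by positivity)
  have hval : 1 / (2 * s) / 2 + 1 / (16 * (1 / (2 * s)) * ν) = 1 / (2 * s) := by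
    field_simp
    nlinarith [hs2]
  linarith [hval]

/-! ### Prop. 4.2 (2) sharpened and its monotonicity -/

/-- **Prop. 4.2 (2) / Remark A.5 sharpened by the antipodal fold:
`S(ν) ≤ νR(ν) - 1 + 1/(2√(2ν))`** for `ν ≥ 3` (`R(ν) = latticeGreen 0`; printed: `S(ν) ≤ νR(ν) - 3/4`).
[cite: SalmhoferSeiler1991, Prop. 4.2 (2) (4.4), Remark A.5 (A.28), Appendix (A.2)–(A.6)] -/
theorem fluctS_le_antipodal (hν : 3 ≤ ν) :
    fluctS ν ≤ ν * latticeGreen (0 : Site ν) - 1 + 1 / (2 * Real.sqrt (2 * ν)) := by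
  rw [fluctS_eq hν]
  have h := one_sub_avgCompTerm_le_half (ν := ν) (by omega)
  linarith

/-- **(A.59) sharpened: `S(ν) ≤ 2/(ν - 2) + 1/(2√(2ν))`** for `ν ≥ 3` (with Lemma A.4,
`R(ν) ≤ 1/(ν - 2)`; printed (A.59)–(4.5): `S(ν) ≤ ν/(ν-2) - 1 + u(ν)/2`).
[cite: SalmhoferSeiler1991, Prop. 4.2 (2)–(3), (A.59)] -/
theorem fluctS_le_antipodal_dim (hν : 3 ≤ ν) :
    fluctS ν ≤ 2 / ((ν : ℝ) - 2) + 1 / (2 * Real.sqrt (2 * ν)) := by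
  have h1 := fluctS_le_antipodal hν
  have h2 := latticeGreen_zero_le_inv_sub_two hν
  have hν' : (3 : ℝ) ≤ ν := by exact_mod_cast hν
  have hνpos : (0 : ℝ) ≤ ν := by linarith
  have h3 : (ν : ℝ) * latticeGreen (0 : Site ν) ≤ ν * (1 / ((ν : ℝ) - 2)) :=
    mul_le_mul_of_nonneg_left h2 hνpos
  have hν2 : (ν : ℝ) - 2 ≠ 0 := by linarith
  have h4 : (ν : ℝ) * (1 / ((ν : ℝ) - 2)) - 1 = 2 / ((ν : ℝ) - 2) := by
    field_simp
    ring
  linarith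

/-- The sharpened bound is decreasing in `ν`: `νR(ν) - 1 + 1/(2√(2ν)) ≤ ν₀R(ν₀) - 1 + 1/(2√(2ν₀))`
for `3 ≤ ν₀ ≤ ν` (Proposition A.6 and `√` increasing). [cite: SalmhoferSeiler1991, Prop. 4.2 (2) with Proposition A.6] -/
theorem antipodalBound_le_of_le {ν₀ : ℕ} (hν₀ : 3 ≤ ν₀) (hle : ν₀ ≤ ν) :
    (ν : ℝ) * latticeGreen (0 : Site ν) - 1 + 1 / (2 * Real.sqrt (2 * ν)) ≤
      (ν₀ : ℝ) * latticeGreen (0 : Site ν₀) - 1 + 1 / (2 * Real.sqrt (2 * ν₀)) := by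
  have h1 := dim_mul_latticeGreen_zero_le_of_le hν₀ hle
  have hν₀' : (0 : ℝ) < ν₀ := by exact_mod_cast (show 0 < ν₀ by omega)
  have hle' : (ν₀ : ℝ) ≤ ν := by exact_mod_cast hle
  have h2 : 1 / (2 * Real.sqrt (2 * ν)) ≤ 1 / (2 * Real.sqrt (2 * ν₀)) := by
    apply one_div_le_one_div_of_le (by positivity)
    exact mul_le_mul_of_nonneg_left (Real.sqrt_le_sqrt (by linarith)) (by norm_num)
  linarith

/-- `S(ν) ≤ ν₀R(ν₀) - 1 + 1/(2√(2ν₀))` for every `ν ≥ ν₀ ≥ 3`. [cite: SalmhoferSeiler1991, (A.61) with Prop. 4.2 (2) and Proposition A.6] -/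
theorem fluctS_le_antipodal_of_le {ν₀ : ℕ} (hν₀ : 3 ≤ ν₀) (hle : ν₀ ≤ ν) :
    fluctS ν ≤ (ν₀ : ℝ) * latticeGreen (0 : Site ν₀) - 1 + 1 / (2 * Real.sqrt (2 * ν₀)) :=
  (fluctS_le_antipodal (hν₀.trans hle)).trans (antipodalBound_le_of_le hν₀ hle)

/-! ### Thm. 4.8 / Cor. 4.9 for all `ν ≥ ν₀` from one inequality at `ν₀` -/

/-- **Thm. 4.8 in all dimensions `ν ≥ ν₀`, antipodal form**: for a complex spin system with
`B = exp(NW)` to order `N`, `w₁ = 1`, `w_k ≥ 0`, if `2(ν₀R(ν₀) - 1 + 1/(2√(2ν₀)))K(N)/N < 1` at some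
`ν₀ ≥ 3`, then in every dimension `ν ≥ ν₀` there are `c > 0`, `L₀` with `|Λ|⁻¹∑_x⟨σ_0σ_x⟩_Λ ≥ c` for
all even `L ≥ L₀`. [cite: SalmhoferSeiler1991, Thm. 4.8 with Prop. 4.2 (2) and Proposition A.6] -/
theorem chiralLRO_of_latticeGreen_lt_antipodal {ν₀ : ℕ} (hν₀ : 3 ≤ ν₀) (hle : ν₀ ≤ ν) {N : ℕ}
    (hN : 1 ≤ N) {a w : ℕ → ℝ} (hlog : HasLog N a w) (ha0 : a 0 = 1) (hw1 : w 1 = 1)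
    (hw : ∀ k, 2 ≤ k → k ≤ N → 0 ≤ w k)
    (hcond : 2 * ((ν₀ : ℝ) * latticeGreen (0 : Site ν₀) - 1 + 1 / (2 * Real.sqrt (2 * ν₀))) *
      sdK N w / N < 1) :
    ∃ c : ℝ, 0 < c ∧ ∃ L₀ : ℕ, ∀ (L : ℕ) [NeZero L], Even L → L₀ ≤ L →
      c ≤ (Fintype.card (TorusSite ν L) : ℝ)⁻¹ *
          ∑ x : TorusSite ν L, expect N 0 a (MvPolynomial.X (0 : TorusSite ν L) * MvPolynomial.X x) := by
  have hK : 0 < sdK N w := lt_of_lt_of_le one_pos (one_le_sdK hN hw1 hw)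
  have hNpos : (0 : ℝ) < N := by exact_mod_cast hN
  refine chiralLRO_of_fluctS_lt (hν₀.trans hle) hN hlog ha0 hw1 hw (lt_of_le_of_lt ?_ hcond)
  have h := fluctS_le_antipodal_of_le (ν := ν) hν₀ hle
  have : 2 * fluctS ν * sdK N w ≤
      2 * ((ν₀ : ℝ) * latticeGreen (0 : Site ν₀) - 1 + 1 / (2 * Real.sqrt (2 * ν₀))) * sdK N w := by
    nlinarith
  exact div_le_div_of_nonneg_right this hNpos.le

/-! ### The (A.60)-type corollaries, conditional on the printed values of `R(ν₀)` -/

/-- `1/(2√8) ≤ 0.177`, `1/(2√10) ≤ 0.1582`, `1/(2√14) ≤ 0.1337`. [folklore] -/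
private theorem inv_two_sqrt_le {x b q : ℝ} (hq : 0 < q) (hb : b ^ 2 ≤ x) (hqb : 1 ≤ 2 * b * q) :
    1 / (2 * Real.sqrt x) ≤ q := by
  have hb' : b ≤ Real.sqrt x := Real.le_sqrt_of_sq_le hb
  have hbpos : 0 < b := by nlinarith
  have hs : 0 < 2 * Real.sqrt x := by nlinarith
  rw [div_le_iff₀ hs]
  nlinarith

/-- **Cor. 4.9 for `U(3)` (`K(3) = 10/3`) in EVERY dimension `ν ≥ 4`, given the computer-assisted
`R(4) < 5/16`** (printed: `R(4) ≤ 0.3100`, p. 430; kernel-checked in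
`LatticeGreenFourCertificate.latticeGreen_four_zero_lt`): `2(4R(4) - 1 + 1/(4√2))(10/3)/3 < 1`.  This
is the printed claim of Cor. 4.9 for `N = 3` ("`N ∈ {1,…,4}`, `ν ≥ 4`"), which the print routes
through the numerics `S(4) < 0.35` of Prop. 4.2 (4); the tree's `u3_chiralLRO_of_latticeGreen_five_lt`
needed `R(5)` and `ν ≥ 5`. [cite: SalmhoferSeiler1991, Cor. 4.9 and (A.60) p. 430] -/
theorem u3_chiralLRO_of_latticeGreen_four_lt' (hR : latticeGreen (0 : Site 4) < 5 / 16)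
    (hν : 4 ≤ ν) :
    ∃ c : ℝ, 0 < c ∧ ∃ L₀ : ℕ, ∀ (L : ℕ) [NeZero L], Even L → L₀ ≤ L →
      c ≤ (Fintype.card (TorusSite ν L) : ℝ)⁻¹ *
          ∑ x : TorusSite ν L, expect 3 0 (uNBondCoeff 3)
            (MvPolynomial.X (0 : TorusSite ν L) * MvPolynomial.X x) := by
  refine chiralLRO_of_latticeGreen_lt_antipodal (ν₀ := 4) (by norm_num) hν (by norm_num)
    (hasLog_uN (by norm_num) (by norm_num)) (uNBondCoeff_zero 3) (uNLogCoeff_one 3)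
    (fun k hk2 hkN => uNLogCoeff_nonneg (by norm_num) k hk2 hkN) ?_
  rw [sdK_uN_three, Nat.cast_ofNat, Nat.cast_ofNat]
  have h8 : 1 / (2 * Real.sqrt (2 * 4)) ≤ (177 / 1000 : ℝ) :=
    inv_two_sqrt_le (b := 2.8249) (by norm_num) (by norm_num) (by norm_num)
  nlinarith

/-- **Cor. 4.9 for `U(4)` (`K(4) = 83/15`) in every dimension `ν ≥ 5`, given the computer-assisted
`R(5) < 6/25`** (printed: `R(5) ≤ 0.2313`): `2(5R(5) - 1 + 1/(2√10))(83/15)/4 < 1` (the tree's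
`u4_chiralLRO_of_latticeGreen_seven_lt` needed `R(7)` and `ν ≥ 7`; `U(4)` at `ν = 4` needs
`S(4) < 0.3614`, Prop. 4.2 (4)). [cite: SalmhoferSeiler1991, Cor. 4.9 and p. 430] -/
theorem u4_chiralLRO_of_latticeGreen_five_lt' (hR : latticeGreen (0 : Site 5) < 6 / 25)
    (hν : 5 ≤ ν) :
    ∃ c : ℝ, 0 < c ∧ ∃ L₀ : ℕ, ∀ (L : ℕ) [NeZero L], Even L → L₀ ≤ L →
      c ≤ (Fintype.card (TorusSite ν L) : ℝ)⁻¹ *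
          ∑ x : TorusSite ν L, expect 4 0 (uNBondCoeff 4)
            (MvPolynomial.X (0 : TorusSite ν L) * MvPolynomial.X x) := by
  refine chiralLRO_of_latticeGreen_lt_antipodal (ν₀ := 5) (by norm_num) hν (by norm_num)
    (hasLog_uN (by norm_num) le_rfl) (uNBondCoeff_zero 4) (uNLogCoeff_one 4)
    (fun k hk2 hkN => uNLogCoeff_nonneg le_rfl k hk2 hkN) ?_
  rw [sdK_uN_four, Nat.cast_ofNat, Nat.cast_ofNat]
  have h10 : 1 / (2 * Real.sqrt (2 * 5)) ≤ (1582 / 10000 : ℝ) :=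
    inv_two_sqrt_le (b := 3.1606) (by norm_num) (by norm_num) (by norm_num)
  nlinarith

/-- **Cor. 4.9 for `U(5)` with the corrected `K(5) = 12227/1330` in every dimension `ν ≥ 7`, given
the computer-assisted `R(7) < 369/2324`** (printed: `R(7) ≤ 0.1564`):
`2(7R(7) - 1 + 1/(2√14))(12227/1330)/5 < 1` (the tree's numerics-free threshold for `N = 5` is
`ν ≥ 94`, `ComplexSpinChiralLROHighDimension.u5_chiralLRO_of_le`). [cite: SalmhoferSeiler1991, Cor. 4.9 (case `N = 5`) and p. 430] -/
theorem u5_chiralLRO_of_latticeGreen_seven_lt (hR : latticeGreen (0 : Site 7) < 369 / 2324)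
    (hν : 7 ≤ ν) :
    ∃ c : ℝ, 0 < c ∧ ∃ L₀ : ℕ, ∀ (L : ℕ) [NeZero L], Even L → L₀ ≤ L →
      c ≤ (Fintype.card (TorusSite ν L) : ℝ)⁻¹ *
          ∑ x : TorusSite ν L, expect 5 0 (uNBondCoeff 5)
            (MvPolynomial.X (0 : TorusSite ν L) * MvPolynomial.X x) := by
  refine chiralLRO_of_latticeGreen_lt_antipodal (ν₀ := 7) (by norm_num) hν (by norm_num)
    hasLog_uN_five (uNBondCoeff_zero 5) (by simp [Function.update, uNLogCoeff])
    (fun k hk2 hk5 => by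
      interval_cases k <;> simp [Function.update, uNLogCoeff] <;> norm_num) ?_
  rw [sdK_uN_five, Nat.cast_ofNat, Nat.cast_ofNat]
  have h14 : 1 / (2 * Real.sqrt (2 * 7)) ≤ (1337 / 10000 : ℝ) :=
    inv_two_sqrt_le (b := 3.7416) (by norm_num) (by norm_num) (by norm_num)
  nlinarith

end ComplexSpin

end Literature.MathematicalPhysics.StatisticalMechanics

end
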